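import Mathlib
import HarnessLib
import Summits.HubbardSuperconductivity.HubbardSuperconductivity.Theorems.KLProgrammeKLRegimeEngineValueClauseReductionV11
import Summits.HubbardSuperconductivity.HubbardSuperconductivity.Theorems.KLProgrammeKLRegimeEngineValueClauseReductionV10G5

/-!
# K3 GEN-6 engine child (`KLRegimeEngineV15`, born with `klEngGeo5` and the slot `EngineBoundsAtV10S`), stub `stub_engine_step_values`:
# the IN-CLASS (E2″-v7) inequality at `klEngGeo5` is a corollary of (E2-v10) at `klEngGeo5` + the history's `PairArrayAtV2 … (n−1)`
# (cell gate-hubbard-kl, seat hubbard-kl-k3c2-p2 g6; value-clause reduction lane)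

`klvr11_pairValueIncrement_inClass` (V10 tokens) with its single package inequality discharged by `klg5_package_ineq_of_isPairClassAt`
(`2^24·2^{-(n−1)} + 10·2^24 ≤ 2^28 = klEngGeo5.ppGain n |Qm|_𝕋` in the pair class).  So on the gen-6 engine skeleton the conjunct (E2″-v7) of
`stub_engine_step_values` is OWED ONLY OUT OF CLASS (`|Qm|_𝕋 > 4^{-n}`, where (E2-v10) is silent and the two-shell pp gain carries the bound), and
(E2′-S4) nowhere separately (`klvr11_quarticValueIncrementAtS4_of_pairValueIncrementAtV7`).  Nothing about the model is asserted.
-/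

noncomputable section

namespace Summit.HubbardSuperconductivity.HubbardSuperconductivity.Theorems.EngineV8

set_option linter.dupNamespace false -- summit = problem name (single-conjunct summit), D-0017

open Real Finset Literature.MathematicalPhysics.QuantumLattice Literature.Probability.LatticeModels
open Summit.HubbardSuperconductivity.HubbardSuperconductivity.Theorems.KLRegimeSplit
open Summit.HubbardSuperconductivity.HubbardSuperconductivity.Theorems.KLProgrammeLegKernels

variable {L M : ℕ} [NeZero L] [NeZero M]

/-- **In-class (E2″-v7) AT THE PACKAGE `klEngGeo5`**: at `n ≥ 1` and every `Qm` with `IsPairClassAt L Qm n`, from (E2-v10) at `klEngGeo5`, the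
history's `PairArrayAtV2 … (n−1)` and the regime smallness (`Klam ≥ 1`, `(C_W + klLegKappa·Q.CR·Klam³)|U| ≤ 1/10`, `|U|·2^24 ≤ 1/8`), the pair-value
increment obeys the (E2″-v7) budget. -/
theorem klvr11_pairValueIncrement_inClass_klEngGeo5 {P : SplitConsts} {Q : EngConsts} {β U μ : ℝ} {K : TrigPolyC4v} {n : ℕ}
    (hn : 1 ≤ n) (hlad : PairLadderStepAtV10 L M klEngGeo5 P Q β U μ K n) (harr : PairArrayAtV2 L M P Q β U μ K (n - 1))
    {Qm : TorusSite 2 L} (hQm : IsPairClassAt L Qm n) (hK : 1 ≤ P.Klam)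
    (hcU : 0 ≤ P.C_W + klLegKappa * Q.CR * P.Klam ^ 3) (hcU' : (P.C_W + klLegKappa * Q.CR * P.Klam ^ 3) * |U| ≤ 1 / 10)
    (hUb : |U| * 2 ^ 24 ≤ 1 / 8) :
    ∀ k ∈ klBall L μ K, ∀ k' ∈ klBall L μ K,
      ‖klPairAmplitude L M β U μ K n Qm k k' - klPairAmplitude L M β U μ K (n - 1) Qm k k'‖ ≤
        gainBar klEngGeo5 P U n (klTorusNorm L Qm) (klTorusNorm L (k - k')) (klTorusNorm L (k + k' - Qm)) +
          eremBar klEngGeo5 P Q U β L (n - 1) + thermalBar klEngGeo5 P U β n +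
            legDressBarQ2 klEngGeo5 P Q U n (legSliceCountT L β μ K n ![k', Qm - k', Qm - k, k]) :=
  klvr11_pairValueIncrement_inClass hn hlad harr hQm hK (by norm_num [klEngGeo5_bhi, klEngGeo4_bhi, klEngGeo3_bhi]) hcU hcU'
    (by rw [klEngGeo5_bhi, klEngGeo4_bhi, klEngGeo3_bhi]; exact hUb) (klg5_package_ineq_of_isPairClassAt n hQm)

end Summit.HubbardSuperconductivity.HubbardSuperconductivity.Theorems.EngineV8

end
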